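import Literature.MathematicalPhysics.QuantumFieldTheory.Balaban1983to89.Node00.N24KnitStage11Carriers
import Literature.MathematicalPhysics.QuantumFieldTheory.Balaban1983to89.Node00.Record11CarriersB12
import Literature.MathematicalPhysics.QuantumFieldTheory.Balaban1983to89.B12NodeKnitRecord11

/-!
# NODE N24 · (B2) AT THE SIX-PIN STAGE-11 CARRIER RECORD `IsRecordOfRecord₁₁CB10YZWB8B12` (seat node00-def g32's `Record11CarriersB12`: the [B12 §§2–5] carrier
# group PINNED to Lemma 4's frame of record on top of the five-pin S-bound record) — module 21 §2's engine at the S-bound world, with N09's B12-group slot READ AT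
# THE PINNED LEAF `B12LeafOfRecord₁₁` and N09 entered BY NAME through seat dag-n09-d's POINTED Stage-11 theorem

TRACK A (YM-PLAN §2d, node N24 of 28 = binder B2 `hB : B16.EndStatementBPrinted D.C`), seat `pub-ymgap-dag-n24-c` (R134 fan-out seat, strategy s2; HANDOFF (t7′) recipe:
«a further carrier pin ⇒ one NEW importing module re-keying the corresponding socket to the pinned bundle's leaf by name»).  A NEW importing module (modules 1–22 untouched;
sequel of module 21 `N24KnitStage11Carriers`).  THEOREMS ONLY, def-free, sorry-free, standard axioms.

WHY.  `IsRecordOfRecord₁₁CB10YZWB8B12 F N D w` (g32) is the five-pin record `…B8` VERBATIM with the [B12 §§2–5] group of the `X` bundle pinned to `F12OfRecord₁₁ θ lam12` over a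
residual `lam12 : ResidB12 F N θ.τ9.M` (the [15]-letters, the class (3.31), the constants — data, no law) and the upstream block the S-binding at the SIX-pin view
`θ.view₁₁B12B8B10YZW lam12 lam Mstar ops ζ lamW`; it REFINES `…B8` WITH THE SAME `(D, w)` (`isRecordOfRecord₁₁CB10YZWB8_of_isRecordOfRecord₁₁CB10YZWB8B12`, witness `θ.pinB12 lam12`),
so module 21 §2's engine `N24_at_record₁₁CB10YZWB8_of_N13_exists` runs unchanged.  What is new: the `b12` leaf of the world IS `B12LeafOfRecord₁₁ F N θ lam12 P`
(`upOfRecord₅CS_view₁₁B12B8B10YZW_leaves`, `Iff.rfl`) — [Balaban1987RG1] Lemma 4 (3.53) AT THE FRAME OF RECORD — so N09's pin slot is displayed AT THE PINNED OBJECTS and N09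
enters BY NAME through seat dag-n09-d's POINTED theorem `B12NodeKnitRecord11.b12_main_stage11_of_leaf_of_hRestrict θ h hC P h12 h11 hres huniq` (valid at ANY world bound to
the Stage-11 construction — the S-bound one included; `Dag.B12_main` reads `b8` only as an antecedent it discards).  Every other child as in module 21 §2, keyed over the
SIX-pin presentations: N05 ← `B8LeafOfRecord θ₃ lam`; N06 ∧ N07 ∧ N12 ← the hidden layers' leaves; N08 ← `PrintedUV3V N L`; N10 ← the B13 socket over the six-pin view (C-bound twin,
`rfl` transport); N11 a binder (ref-C (B8-2)); N13 world-level (`hR` + `hcor3`, module 21's face at the five-pin refinement).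

WHAT THIS FILE PROVES.
§1 `N24_b9_b11_b15_b10_b8_main_of_isRecordOfRecord₁₁CB10YZWB8B12_of_slots` (N06 N07 N12 N08 N05 from the six pinned leaves), `N24_b13_main_of_isRecordOfRecord₁₁CB10YZWB8B12_of_slot`
   (N10 via the C-bound twin), `N24_b12_main_of_isRecordOfRecord₁₁CB10YZWB8B12_of_slots` (N09 BY NAME: the pin slot `B12LeafOfRecord₁₁` + [Balaban1985Variational] Thm 1 on
   `domAltOfRecord` ×3, dag-n09-d's pointed theorem at the record's presenting `θ`).
§2 **`N24_at_record₁₁CB10YZWB8B12_knit_all_carriers_pinned`** — WHICH CHILD BLOCKS at the six-pin record, kernel form: N05 `hB8`; N06 ∧ N07 ∧ N12 `hYZW`; N08 `hUV₀₈`; N09 `hB12` (the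
   pinned Lemma-4 leaf — NODE 00's `B12Package` is its closer shape) + `h11dom` ∕ `hres` ∕ `huniq`; N10 `slots₁₀`; N11 ×1 binder; N13 𝐑-leaf + Cor.-3; β ×2; K0 at ₁₁.

VACUITY STATUS AT ₁₁ AS PINNED (seat dag-n13-e's located typing flag, cell bus 2026-08-26T15:10Z; referee dag-ref-D's VACUITY-AMENDMENT 15:41Z): the level-0 §2 base is
unsatisfiable at Stage 11 as pinned, so (B) fails at every windowed Stage-11 record and every (B2) knit at ₁₁ — this one included — is a CORRECT IMPLICATION WITH JOINTLY
UNSATISFIABLE HYPOTHESES there: the WIRING of record for the six-pin chain, to be re-keyed by name at def-T's repaired Stage-12 record when node00-def re-instantiates the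
chain there.  Inhabitation of the chain = item K0 (g32 `exists_world_…`); the hidden-layer hypotheses are junk-closable (strength-neutral, location-positive).
HONEST FRAMING: kernel bookkeeping BY NAME; nothing of Bałaban's asserted; every slot DISPLAYED; N24 COMPOSITE — no discharge, no count; one finite T⁴ programme at fixed ε;
NOT continuum ∕ ℝ⁴ ∕ OS ∕ mass gap ∕ Clay.
-/

noncomputable section

open scoped Matrix.Norms.L2Operator

namespace Literature.MathematicalPhysics.QuantumFieldTheory.Balaban1983to89.Node00

open DagBinding T4Continuum T4DatumAssembly FlowStepRuns AveragingRT
open FlowStep (box_mono)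

variable {F : T4Family} {N : ℕ} [NeZero N] {D : FiniteEpsData F (SU N)} {w : WorldP}

/-! ## §1. The children at the six-pin record from the pinned leaves -/

/-- **N06 ∕ N07 ∕ N12 ∕ N08 ∕ N05 AT A SIX-PIN STAGE-11 RECORD FROM THE PINNED LEAVES**: «for every presenting `(θ, h, λ12, λ, M⋆, ops, ζ, λW)`: def-Y's leaf ∧ the [B11] leaf ∧
the [IV] leaves» (hidden layers), the printed slot `PrintedUV3V N L` at the world's odd `L > 1`, and «the SURVIVING [Balaban1985RegularSpaces] leaf at the group of record
`B8LeafOfRecord θ₃ λ`» give `Dag.B9_main ∧ Dag.B11_main ∧ Dag.B15_main ∧ Dag.B10_main ∧ Dag.B8_main` at every run (g32's `upOfRecord₅CS_view₁₁B12B8B10YZW_leaves`; the DAG sentences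
discard their in-edges). [cite: Balaban1985BackgroundPropagators, Thms 3.1–3.15 pp.397–432; Balaban1985Variational, Thm 1 p.279; Balaban1989LargeFieldI, Prop. 1 p.194; Balaban1985UV3, Thm 1 p.257 + Thm 2 p.272; Balaban1985RegularSpaces, Lemma 1 – Thm 8 pp.79–101 (the nodes' shapes at the pinned objects; bookkeeping)] -/
theorem N24_b9_b11_b15_b10_b8_main_of_isRecordOfRecord₁₁CB10YZWB8B12_of_slots (h : IsRecordOfRecord₁₁CB10YZWB8B12 F N D w)
    (hYZW : ∀ (θ : Stage11Params F N) (hP : θ.Provisos₁₁) (lam12 : ResidB12 F N θ.τ9.M) (lam : ResidB8 θ.toStage3Params) (Mstar : ℕ)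
      (ops : OpsY N θ.toStage3Params Mstar) (ζ : ResidZ F N) (lamW : ResidW F N), θ.Admissible → D = datumOfRecord₁₁ F N θ hP →
        (∀ P, w.up P = upOfRecord₅CS F N (θ.view₁₁B12B8B10YZW F N lam12 lam Mstar ops ζ lamW) P) →
          B9LeafX (Y9OfRecord N θ.toStage3Params Mstar ops) ∧ B11Leaf (Z11OfRecord F N ζ) ∧ ∀ P : B12.RunParams, B15Leaf (WOfRecord₁₁ F N θ lamW P))
    (hUV₀₈ : ∀ L : ℕ, Odd L → 1 < L → w.L = (L : ℝ) → PrintedUV3V N L)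
    (hB8 : ∀ (θ : Stage11Params F N) (hP : θ.Provisos₁₁) (lam12 : ResidB12 F N θ.τ9.M) (lam : ResidB8 θ.toStage3Params) (Mstar : ℕ)
      (ops : OpsY N θ.toStage3Params Mstar) (ζ : ResidZ F N) (lamW : ResidW F N), θ.Admissible → D = datumOfRecord₁₁ F N θ hP →
        (∀ P, w.up P = upOfRecord₅CS F N (θ.view₁₁B12B8B10YZW F N lam12 lam Mstar ops ζ lamW) P) → B8LeafOfRecord θ.toStage3Params lam)
    (P : B12.RunParams) :
    Dag.B9_main (leavesP w P) ∧ Dag.B11_main (leavesP w P) ∧ Dag.B15_main (leavesP w P) ∧ Dag.B10_main (leavesP w P) ∧ Dag.B8_main (leavesP w P) := by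
  obtain ⟨θ, hP, lam12, lam, Mstar, ops, ζ, lamW, hθ, hD, -, -, hL, hup⟩ := h
  have hl := upOfRecord₅CS_view₁₁B12B8B10YZW_leaves F N θ lam12 lam Mstar ops ζ lamW P
  obtain ⟨h9, h11, h15⟩ := hYZW θ hP lam12 lam Mstar ops ζ lamW hθ hD hup
  have h8 := hB8 θ hP lam12 lam Mstar ops ζ lamW hθ hD hup
  refine ⟨fun _ _ _ _ => ?_, fun _ _ _ _ _ => ?_, fun _ _ _ _ _ => ?_, fun _ _ _ _ _ _ => ?_, fun _ _ _ _ => ?_⟩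
  · show (w.up P).b9
    rw [hup P]; exact hl.2.2.2.1.2 h9
  · show (w.up P).b11
    rw [hup P]; exact hl.2.2.2.2.2.2 h11
  · show (w.up P).rBasicStep
    rw [hup P]; exact hl.2.2.1.2 (h15 P)
  · show (w.up P).b10
    rw [hup P]; exact hl.2.2.2.2.1.2 (hUV₀₈ θ.L θ.hL.1 θ.hL.2 hL)
  · show (w.up P).b8
    rw [hup P]; exact hl.2.1.2 h8

/-- **N10 · [Balaban1988RG2Cluster] AT A SIX-PIN STAGE-11 RECORD FROM THE B13 SOCKET OVER THE SIX-PIN VIEW** (`B13NodeKnitRecord5C.b13_main_at_stage5ParamsC` at the C-bound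
twin world; `Dag.B13_main` reads no `b8`, the S-binding re-binds `b8` alone ⇒ `rfl` transport).  The socket's groups: [B10] runs, Y, Z, the B12 frame PINNED; B13 residual.
[cite: Balaban1988RG2Cluster, Lemmas 1–3 pp.9, 11, 20 (the node's shape at the six-pin view; bookkeeping)] -/
theorem N24_b13_main_of_isRecordOfRecord₁₁CB10YZWB8B12_of_slot (h : IsRecordOfRecord₁₁CB10YZWB8B12 F N D w)
    (slots₁₀ : ∀ (θ : Stage11Params F N) (hP : θ.Provisos₁₁) (lam12 : ResidB12 F N θ.τ9.M) (lam : ResidB8 θ.toStage3Params) (Mstar : ℕ)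
      (ops : OpsY N θ.toStage3Params Mstar) (ζ : ResidZ F N) (lamW : ResidW F N), θ.Admissible → D = datumOfRecord₁₁ F N θ hP →
        (∀ P, w.up P = upOfRecord₅CS F N (θ.view₁₁B12B8B10YZW F N lam12 lam Mstar ops ζ lamW) P) → ∀ P : B12.RunParams,
          B9LeafX ((θ.view₁₁B12B8B10YZW F N lam12 lam Mstar ops ζ lamW).res.Y P) →
            (B10.Thm1PrintedCompact ((θ.view₁₁B12B8B10YZW F N lam12 lam Mstar ops ζ lamW).res.X P).runs10 ∧
                B10.Thm2Printed ((θ.view₁₁B12B8B10YZW F N lam12 lam Mstar ops ζ lamW).res.X P).runs10) →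
              B11Leaf ((θ.view₁₁B12B8B10YZW F N lam12 lam Mstar ops ζ lamW).res.Z P) →
                B12Sec2to5.Lemma4Printed ((θ.view₁₁B12B8B10YZW F N lam12 lam Mstar ops ζ lamW).res.X P).F12
                    ((θ.view₁₁B12B8B10YZW F N lam12 lam Mstar ops ζ lamW).res.X P).c12 →
                  B13.Lemma1Printed ((θ.view₁₁B12B8B10YZW F N lam12 lam Mstar ops ζ lamW).res.X P).S13
                      ((θ.view₁₁B12B8B10YZW F N lam12 lam Mstar ops ζ lamW).res.X P).c13 ∧
                    B13.Lemma2Printed ((θ.view₁₁B12B8B10YZW F N lam12 lam Mstar ops ζ lamW).res.X P).S13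
                      ((θ.view₁₁B12B8B10YZW F N lam12 lam Mstar ops ζ lamW).res.X P).c13 ∧
                      B13.Lemma3Printed ((θ.view₁₁B12B8B10YZW F N lam12 lam Mstar ops ζ lamW).res.X P).S13
                        ((θ.view₁₁B12B8B10YZW F N lam12 lam Mstar ops ζ lamW).res.X P).c13)
    (P : B12.RunParams) : Dag.B13_main (leavesP w P) := by
  obtain ⟨θ, hP, lam12, lam, Mstar, ops, ζ, lamW, hθ, hD, -, -, -, hup⟩ := h
  have h' : Dag.B13_main (leavesP { w with up := fun P => upOfRecord₅C F N (θ.view₁₁B12B8B10YZW F N lam12 lam Mstar ops ζ lamW) P } P) :=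
    B13NodeKnitRecord5C.b13_main_at_stage5ParamsC F N (θ.view₁₁B12B8B10YZW F N lam12 lam Mstar ops ζ lamW) _ P rfl
      (slots₁₀ θ hP lam12 lam Mstar ops ζ lamW hθ hD hup P)
  show (w.up P).b9 → (w.up P).b10 → (w.up P).b11 → (w.up P).b12 → (w.up P).b13
  rw [hup P]
  exact h'

/-- **N09 · [Balaban1987RG1] AT A SIX-PIN STAGE-11 RECORD, BY NAME** — seat dag-n09-d's POINTED Stage-11 theorem `B12NodeKnitRecord11.b12_main_stage11_of_leaf_of_hRestrict` at the
record's presenting `θ` (the world IS bound to `(datumOfRecord₁₁ F N θ h).C`; the S-binding is immaterial — `Dag.B12_main` discards its `b8` antecedent): the own leaf `b12` of the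
world IS the PINNED Lemma-4 leaf `B12LeafOfRecord₁₁ F N θ λ12 P` ([Balaban1987RG1] Lemma 4 (3.53) at g32's frame of record `F12OfRecord₁₁`; slot `hB12`, closer shape = NODE 00's
`b12LeafOfRecord₁₁_of_package` over `B12Package`), and the Theorem-3 member comes from [Balaban1985Variational] Thm 1 (8)–(10) at the record's level domains `domAltOfRecord F N θ.ν`
(`h11dom`, `hres`, `huniq`; `contT` via `Provisos₁₁.base`). [cite: Balaban1987RG1, Thm 1 p.259, Thm 3 p.264, Lemma 4 (3.53) p.280, (1.1)–(1.3) p.260; Balaban1985Variational, Thm 1 (8)–(10) p.279 (node bookkeeping at the six-pin record)] -/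
theorem N24_b12_main_of_isRecordOfRecord₁₁CB10YZWB8B12_of_slots (h : IsRecordOfRecord₁₁CB10YZWB8B12 F N D w)
    (hB12 : ∀ (θ : Stage11Params F N) (hP : θ.Provisos₁₁) (lam12 : ResidB12 F N θ.τ9.M) (lam : ResidB8 θ.toStage3Params) (Mstar : ℕ)
      (ops : OpsY N θ.toStage3Params Mstar) (ζ : ResidZ F N) (lamW : ResidW F N), θ.Admissible → D = datumOfRecord₁₁ F N θ hP →
        (∀ P, w.up P = upOfRecord₅CS F N (θ.view₁₁B12B8B10YZW F N lam12 lam Mstar ops ζ lamW) P) → ∀ P : B12.RunParams, B12LeafOfRecord₁₁ F N θ lam12 P)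
    (h11dom : ∀ (θ : Stage11Params F N) (hP : θ.Provisos₁₁) (lam12 : ResidB12 F N θ.τ9.M) (lam : ResidB8 θ.toStage3Params) (Mstar : ℕ)
      (ops : OpsY N θ.toStage3Params Mstar) (ζ : ResidZ F N) (lamW : ResidW F N), θ.Admissible → D = datumOfRecord₁₁ F N θ hP →
        (∀ P, w.up P = upOfRecord₅CS F N (θ.view₁₁B12B8B10YZW F N lam12 lam Mstar ops ζ lamW) P) →
          ∀ (p : B12.RunParams) (k : ℕ), k ≤ p.K →
            ∀ V ∈ domAltOfRecord F N θ.ν p.K k, UkExists F N p.K k θ.εbg V ∧ UniqueUkOrbit F N p.K k θ.εbg V)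
    (hres : ∀ (θ : Stage11Params F N) (hP : θ.Provisos₁₁) (lam12 : ResidB12 F N θ.τ9.M) (lam : ResidB8 θ.toStage3Params) (Mstar : ℕ)
      (ops : OpsY N θ.toStage3Params Mstar) (ζ : ResidZ F N) (lamW : ResidW F N), θ.Admissible → D = datumOfRecord₁₁ F N θ hP →
        (∀ P, w.up P = upOfRecord₅CS F N (θ.view₁₁B12B8B10YZW F N lam12 lam Mstar ops ζ lamW) P) →
          ∀ (p : B12.RunParams) (k : ℕ), k ≤ p.K → HRestrict F N θ.εbg p.K k (domAltOfRecord F N θ.ν p.K k))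
    (huniq : ∀ (θ : Stage11Params F N) (hP : θ.Provisos₁₁) (lam12 : ResidB12 F N θ.τ9.M) (lam : ResidB8 θ.toStage3Params) (Mstar : ℕ)
      (ops : OpsY N θ.toStage3Params Mstar) (ζ : ResidZ F N) (lamW : ResidW F N), θ.Admissible → D = datumOfRecord₁₁ F N θ hP →
        (∀ P, w.up P = upOfRecord₅CS F N (θ.view₁₁B12B8B10YZW F N lam12 lam Mstar ops ζ lamW) P) →
          ∀ (p : B12.RunParams) (k : ℕ), k ≤ p.K → ∀ V ∈ domAltOfRecord F N θ.ν p.K k, ∀ j < k,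
            UniqueUkOrbit F N p.K (j + 1) θ.εbg (Averaging.iter (avOfRecord F N p.K) (j + 1) (Uk F N p.K k θ.εbg V)))
    (P : B12.RunParams) : Dag.B12_main (leavesP w P) := by
  obtain ⟨θ, hP, lam12, lam, Mstar, ops, ζ, lamW, hθ, hD, hC, -, -, hup⟩ := h
  have h12 : (leavesP w P).b12 := by
    show (w.up P).b12
    rw [hup P]
    exact (upOfRecord₅CS_view₁₁B12B8B10YZW_b12_iff F N θ lam12 lam Mstar ops ζ lamW P).2 (hB12 θ hP lam12 lam Mstar ops ζ lamW hθ hD hup P)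
  exact B12NodeKnitRecord11.b12_main_stage11_of_leaf_of_hRestrict θ hP (by rw [hC, hD]) P h12
    (h11dom θ hP lam12 lam Mstar ops ζ lamW hθ hD hup P) (hres θ hP lam12 lam Mstar ops ζ lamW hθ hD hup P)
    (huniq θ hP lam12 lam Mstar ops ζ lamW hθ hD hup P)

/-! ## §2. (B2) at the six-pin record: every pinned child at its statement of record, N09 by name -/

/-- **N24 · (B2) AT THE SIX-PIN STAGE-11 CARRIER RECORD, THE PINNED CHILDREN AT THEIR STATEMENTS OF RECORD, N09 BY NAME** (module 21 §2's engine
`N24_at_record₁₁CB10YZWB8_of_N13_exists` at the five-pin refinement, same `(D, w)`): **N05** ← `hB8`; **N06 ∧ N07 ∧ N12** ← `hYZW`; **N08** ← `hUV₀₈`; **N09** ← the PINNED Lemma-4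
leaf `hB12` + [Balaban1985Variational] Thm 1 ×3 (§1, dag-n09-d by name); **N10** ← `slots₁₀`; **N11** the one by-name binder `h11` (its sentence reads `b8`: ref-C (B8-2)); **N13**
world-level `hR` + `hcor3` (module 21's `N24_b16_main_withExp_of_isRecordOfRecord₁₁CB10YZWB8`); β-box on `D.βfun`.  WHICH CHILD BLOCKS at `₁₁CB10YZWB8B12`, kernel form:
N05 surviving-leaf slot; N06 ∧ N07 ∧ N12 hidden-layer leaves; N08 one printed ∃-slot; N09 the pinned Lemma-4 leaf (closer: NODE 00's `B12Package`) + Thm 1 ×3; N10 one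
residual socket; N11 ×1; N13 𝐑-leaf + Cor.-3; β ×2; K0 at ₁₁. [cite: Balaban1989LargeFieldII, Thm 1 p.355, (0.1) pp.355–356, p.387, p.391; Balaban1987RG1, Thm 1 p.259, Thm 3 p.264, Lemma 4 (3.53) p.280, (1.22) p.264; Balaban1985Variational, Thm 1 (8)–(10) p.279; Balaban1985RegularSpaces, Thm 8 p.101; Balaban1985UV3, Thm 1 p.257 + Thm 2 p.272; Balaban1985BackgroundPropagators, Thms 3.1–3.15 pp.397–432; Balaban1988Convergent, Thm 1 p.262, Thm 2 p.263, p.244, Cor. 3 (2.50) p.264; Balaban1988RG2Cluster, Lemmas 1–3 pp.9, 11, 20; Balaban1989LargeFieldI, Prop. 1 p.194 (bookkeeping over the six-pin Stage-11 record)] -/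
theorem N24_at_record₁₁CB10YZWB8B12_knit_all_carriers_pinned (h : IsRecordOfRecord₁₁CB10YZWB8B12 F N D w) {γ₀ : ℝ} (hγ₀ : w.γ ≤ γ₀)
    (hB8 : ∀ (θ : Stage11Params F N) (hP : θ.Provisos₁₁) (lam12 : ResidB12 F N θ.τ9.M) (lam : ResidB8 θ.toStage3Params) (Mstar : ℕ)
      (ops : OpsY N θ.toStage3Params Mstar) (ζ : ResidZ F N) (lamW : ResidW F N), θ.Admissible → D = datumOfRecord₁₁ F N θ hP →
        (∀ P, w.up P = upOfRecord₅CS F N (θ.view₁₁B12B8B10YZW F N lam12 lam Mstar ops ζ lamW) P) → B8LeafOfRecord θ.toStage3Params lam)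
    (hYZW : ∀ (θ : Stage11Params F N) (hP : θ.Provisos₁₁) (lam12 : ResidB12 F N θ.τ9.M) (lam : ResidB8 θ.toStage3Params) (Mstar : ℕ)
      (ops : OpsY N θ.toStage3Params Mstar) (ζ : ResidZ F N) (lamW : ResidW F N), θ.Admissible → D = datumOfRecord₁₁ F N θ hP →
        (∀ P, w.up P = upOfRecord₅CS F N (θ.view₁₁B12B8B10YZW F N lam12 lam Mstar ops ζ lamW) P) →
          B9LeafX (Y9OfRecord N θ.toStage3Params Mstar ops) ∧ B11Leaf (Z11OfRecord F N ζ) ∧ ∀ P : B12.RunParams, B15Leaf (WOfRecord₁₁ F N θ lamW P))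
    (hUV₀₈ : ∀ L : ℕ, Odd L → 1 < L → w.L = (L : ℝ) → PrintedUV3V N L)
    (hB12 : ∀ (θ : Stage11Params F N) (hP : θ.Provisos₁₁) (lam12 : ResidB12 F N θ.τ9.M) (lam : ResidB8 θ.toStage3Params) (Mstar : ℕ)
      (ops : OpsY N θ.toStage3Params Mstar) (ζ : ResidZ F N) (lamW : ResidW F N), θ.Admissible → D = datumOfRecord₁₁ F N θ hP →
        (∀ P, w.up P = upOfRecord₅CS F N (θ.view₁₁B12B8B10YZW F N lam12 lam Mstar ops ζ lamW) P) → ∀ P : B12.RunParams, B12LeafOfRecord₁₁ F N θ lam12 P)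
    (h11dom : ∀ (θ : Stage11Params F N) (hP : θ.Provisos₁₁) (lam12 : ResidB12 F N θ.τ9.M) (lam : ResidB8 θ.toStage3Params) (Mstar : ℕ)
      (ops : OpsY N θ.toStage3Params Mstar) (ζ : ResidZ F N) (lamW : ResidW F N), θ.Admissible → D = datumOfRecord₁₁ F N θ hP →
        (∀ P, w.up P = upOfRecord₅CS F N (θ.view₁₁B12B8B10YZW F N lam12 lam Mstar ops ζ lamW) P) →
          ∀ (p : B12.RunParams) (k : ℕ), k ≤ p.K →
            ∀ V ∈ domAltOfRecord F N θ.ν p.K k, UkExists F N p.K k θ.εbg V ∧ UniqueUkOrbit F N p.K k θ.εbg V)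
    (hres : ∀ (θ : Stage11Params F N) (hP : θ.Provisos₁₁) (lam12 : ResidB12 F N θ.τ9.M) (lam : ResidB8 θ.toStage3Params) (Mstar : ℕ)
      (ops : OpsY N θ.toStage3Params Mstar) (ζ : ResidZ F N) (lamW : ResidW F N), θ.Admissible → D = datumOfRecord₁₁ F N θ hP →
        (∀ P, w.up P = upOfRecord₅CS F N (θ.view₁₁B12B8B10YZW F N lam12 lam Mstar ops ζ lamW) P) →
          ∀ (p : B12.RunParams) (k : ℕ), k ≤ p.K → HRestrict F N θ.εbg p.K k (domAltOfRecord F N θ.ν p.K k))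
    (huniq : ∀ (θ : Stage11Params F N) (hP : θ.Provisos₁₁) (lam12 : ResidB12 F N θ.τ9.M) (lam : ResidB8 θ.toStage3Params) (Mstar : ℕ)
      (ops : OpsY N θ.toStage3Params Mstar) (ζ : ResidZ F N) (lamW : ResidW F N), θ.Admissible → D = datumOfRecord₁₁ F N θ hP →
        (∀ P, w.up P = upOfRecord₅CS F N (θ.view₁₁B12B8B10YZW F N lam12 lam Mstar ops ζ lamW) P) →
          ∀ (p : B12.RunParams) (k : ℕ), k ≤ p.K → ∀ V ∈ domAltOfRecord F N θ.ν p.K k, ∀ j < k,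
            UniqueUkOrbit F N p.K (j + 1) θ.εbg (Averaging.iter (avOfRecord F N p.K) (j + 1) (Uk F N p.K k θ.εbg V)))
    (slots₁₀ : ∀ (θ : Stage11Params F N) (hP : θ.Provisos₁₁) (lam12 : ResidB12 F N θ.τ9.M) (lam : ResidB8 θ.toStage3Params) (Mstar : ℕ)
      (ops : OpsY N θ.toStage3Params Mstar) (ζ : ResidZ F N) (lamW : ResidW F N), θ.Admissible → D = datumOfRecord₁₁ F N θ hP →
        (∀ P, w.up P = upOfRecord₅CS F N (θ.view₁₁B12B8B10YZW F N lam12 lam Mstar ops ζ lamW) P) → ∀ P : B12.RunParams,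
          B9LeafX ((θ.view₁₁B12B8B10YZW F N lam12 lam Mstar ops ζ lamW).res.Y P) →
            (B10.Thm1PrintedCompact ((θ.view₁₁B12B8B10YZW F N lam12 lam Mstar ops ζ lamW).res.X P).runs10 ∧
                B10.Thm2Printed ((θ.view₁₁B12B8B10YZW F N lam12 lam Mstar ops ζ lamW).res.X P).runs10) →
              B11Leaf ((θ.view₁₁B12B8B10YZW F N lam12 lam Mstar ops ζ lamW).res.Z P) →
                B12Sec2to5.Lemma4Printed ((θ.view₁₁B12B8B10YZW F N lam12 lam Mstar ops ζ lamW).res.X P).F12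
                    ((θ.view₁₁B12B8B10YZW F N lam12 lam Mstar ops ζ lamW).res.X P).c12 →
                  B13.Lemma1Printed ((θ.view₁₁B12B8B10YZW F N lam12 lam Mstar ops ζ lamW).res.X P).S13
                      ((θ.view₁₁B12B8B10YZW F N lam12 lam Mstar ops ζ lamW).res.X P).c13 ∧
                    B13.Lemma2Printed ((θ.view₁₁B12B8B10YZW F N lam12 lam Mstar ops ζ lamW).res.X P).S13
                      ((θ.view₁₁B12B8B10YZW F N lam12 lam Mstar ops ζ lamW).res.X P).c13 ∧
                      B13.Lemma3Printed ((θ.view₁₁B12B8B10YZW F N lam12 lam Mstar ops ζ lamW).res.X P).S13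
                        ((θ.view₁₁B12B8B10YZW F N lam12 lam Mstar ops ζ lamW).res.X P).c13)
    (h11 : ∀ P : B12.RunParams, Dag.B14_main (leavesP w P))
    (hR : ∀ P : B12.RunParams, (w.up P).rOperation)
    (hcor3 : ∃ (em ep : ℝ → ℝ) (R : B14Cor3.ReprFamily D.C),
      B14Cor3.LeafH D.C R w.γ ∧ B14Cor3.LeafU1 D.C R w.γ ∧ B14Cor3.LeafU2 D.C R w.γ ep ∧ B14Cor3.LeafL1 D.C R w.γ ∧ B14Cor3.LeafL2 D.C R w.γ em)
    (hlo : FlowStep.BetaLowerH w.b γ₀ D.βfun) (hhi : FlowStep.BetaUpperH w.βup γ₀ D.βfun) :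
    B16.EndStatementBPrinted D.C :=
  have h₅ := isRecordOfRecord₁₁CB10YZWB8_of_isRecordOfRecord₁₁CB10YZWB8B12 h
  have h4 := N24_b9_b11_b15_b10_b8_main_of_isRecordOfRecord₁₁CB10YZWB8B12_of_slots h hYZW hUV₀₈ hB8
  N24_at_record₁₁CB10YZWB8_of_N13_exists h₅ hγ₀ (fun P => (h4 P).2.2.2.2) (fun P => (h4 P).1) (fun P => (h4 P).2.1)
    (fun P => (h4 P).2.2.2.1) (N24_b12_main_of_isRecordOfRecord₁₁CB10YZWB8B12_of_slots h hB12 h11dom hres huniq)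
    (N24_b13_main_of_isRecordOfRecord₁₁CB10YZWB8B12_of_slot h slots₁₀) h11 (fun P => (h4 P).2.2.1)
    (N24_b16_main_withExp_of_isRecordOfRecord₁₁CB10YZWB8 h₅ hR hcor3) hlo hhi

end Literature.MathematicalPhysics.QuantumFieldTheory.Balaban1983to89.Node00

end
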